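import Literature.NumberTheory.PAdicHodge.BdRPlusLogTeich
import Literature.NumberTheory.PAdicHodge.ReciprocityCalibrationSocket
import HarnessLib

/-!
# UNIFORM kernel of `θ` on the Teichmüller logarithms: `X⁰_k ∩ ker θ ⊆ p⁻¹ ℤ_p · t + Fil^k`

Topic `Literature/NumberTheory/PAdicHodge`; THEOREMS ONLY (no definition, no named fact, no instance, no `sorry`). Sequel of
`BdRPlusLogTeich` (the `ℤ_p[Γ_F]`-module `X⁰_k` of Teichmüller logarithms `log[x] mod Fil^k`, `x ∈ 𝒪_{ℂ_F}♭`, `x₀ = 1`, with KERNEL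
`IsTeichLog.exists_pow_mul_sub_mul_tBdR_mem`: `θ L = 0 ⟹ p^N L − a·t ∈ ξ^k B_dR⁺` for SOME `N`) and of `CompletedAlgClosurePadicNorm`
(`log = 0` on `1 + 𝔪_{ℂ_F}` forces a `p`-power root of unity). The exponent `N` there depends on `L`; here it is made UNIFORM:

* §1 ★ `CompletedAlgClosure.pow_prime_eq_one_of_hasSum_log_zero_of_norm_le` — **if `‖1 − x‖ ≤ ‖p‖` in `ℂ_F` and the logarithm series
  of `x` sums to `0`, then `x^p = 1`** (so `x = 1` for odd `p`, `x = ±1` for `p = 2`): `‖1 − x^p‖ ≤ ‖p‖² = p⁻²` (`norm_one_sub_pow_le`,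
  ultrametric) lies inside the ball on which the series is injective (IUT `logSeries_injOn`, radius `ρ` with `ρ · p^{1/(p−1)} < 1`).
* §2 ★★ `IsLogModFil.exists_prime_mul_sub_mul_tBdR_mem` / `IsTeichLog.exists_prime_mul_sub_mul_tBdR_mem` — **UNIFORM KERNEL**: for
  `k ≥ 1` and a Teichmüller logarithm `L` modulo `Fil^k` with `θ(L) = 0` there is `a ∈ ℤ_p` with **`p · L − a · t ∈ ξ^k B_dR⁺`** (`N = 1`
  for every `p`): the arguments `x` have `x₀ = 1`, i.e. `‖x♯ − 1‖ ≤ ‖p‖`, so §1 gives `(x♯)^p = 1`, hence `x^p = ε^a`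
  (`TiltUntiltKernel`) and `p·L`, `a·t` are two logarithms of `[ε^a]`.
* §3 (currency of the assembly socket `ReciprocityCalibrationSocket`: `BdRPlusTop F p`, the period line `ι : ℤ_p(1) → B_dR⁺`,
  `Fil² = WithIdeal.i ^ 2`) ★ `exists_periodLine_sub_mem_sq_of_isTeichLog` — a cochain `E : Γ → B_dR⁺` with values Teichmüller logarithms
  modulo `Fil²` killed by `θ` is, after multiplication by `p`, **congruent modulo `Fil²` to `ι ∘ h` for a UNIQUE `h : Γ → ℤ_p(1)`**
  (`periodLine_unique_mod_pow`: `ℤ_p · t ∩ Fil² = 0`); and `h` inherits every algebraic identity of `E` (`h` of a sum, cochain identity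
  `sub_periodLine_cochain_identity`). Continuity of `h` is NOT addressed here.

Use (line `kato_lever` of crux K★ `stmt-BirchSwinnertonDyer-22226`, (H4) step (3)): in the recognition of the Legendre cochain
(`TatePairingCochainLegendre`) the `X₂`-valued error cochain `E` (difference of the presenting cochain and the calibration cochain, `θ ∘ E = 0`)
is `≡ ι ∘ h (mod Fil²)` with ONE exponent `p`, as the socket `tatePairingPoint_eq_neg_trace_of_recognition` requires. Infrastructure only;
BSD / K★ / [REC] are NOT proved by any of this.

## References
* N. Koblitz, *p-adic Numbers, p-adic Analysis, and Zeta-Functions*, GTM 58 (1984), Ch. IV §1–2 (the logarithm is an isometry on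
  `1 + p𝒪` for odd `p`). [Koblitz1984]
* J.-M. Fontaine, Y. Ouyang, *Theory of p-adic Galois representations*, §6.1 (`U → B_crys^{φ=p}`, the fundamental exact sequence). [FontaineOuyang2022]
* J.-M. Fontaine, *Le corps des périodes p-adiques*, Astérisque 223 (1994), Exp. II §1.2.2–1.2.3, §1.5.4. [FontaineAsterisque223III]
* J. Neukirch, *Algebraic Number Theory* (1999), Ch. II (5.4)–(5.5). [NeukirchANT1999]
-/

noncomputable section

namespace Literature.NumberTheory.PAdicHodge

open ValuativeRel Field Ideal WittVector
open Literature.NumberTheory.GaloisRepresentations Literature.NumberTheory.GaloisRepresentations.IsNonarchimedeanLocalField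
open Literature.IUT.LogVolume

/-! ## §1 `‖1 − x‖ ≤ ‖p‖` and `log x = 0` force `x^p = 1` in `ℂ_F` -/

section NormEstimate

variable {K : Type*} [NormedField K] [IsUltrametricDist K]

/-- `‖1 − yⁱ‖ ≤ ‖1 − y‖` for `‖1 − y‖ ≤ 1` (ultrametric: `1 − yⁱ⁺¹ = (1 − yⁱ) + yⁱ(1 − y)`, `‖y‖ ≤ 1`). [cite: NeukirchANT1999, Ch. II (5.4)] -/
theorem norm_one_sub_pow_le_norm_one_sub {y : K} (hy : ‖1 - y‖ ≤ 1) (i : ℕ) : ‖1 - y ^ i‖ ≤ ‖1 - y‖ := by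
  have hy1 : ‖y‖ ≤ 1 := by
    have e : y = 1 + -(1 - y) := by ring
    rw [e]
    exact (IsUltrametricDist.norm_add_le_max _ _).trans (max_le (by rw [norm_one]) (by rw [norm_neg]; exact hy))
  induction i with
  | zero => rw [pow_zero, sub_self, norm_zero]; exact norm_nonneg _
  | succ i ih =>
    have e : (1 : K) - y ^ (i + 1) = (1 - y ^ i) + y ^ i * (1 - y) := by ring
    rw [e]
    refine (IsUltrametricDist.norm_add_le_max _ _).trans (max_le ih ?_)
    rw [norm_mul, norm_pow]
    exact mul_le_of_le_one_left (norm_nonneg _) (pow_le_one₀ (norm_nonneg _) hy1)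

/-- **`‖1 − yⁿ‖ ≤ r · ‖1 − y‖` when `‖1 − y‖ ≤ r ≤ 1` and `‖n‖ ≤ r`**: `1 − yⁿ = (Σ_{i<n} yⁱ)(1 − y)` and
`Σ_{i<n} yⁱ = n − Σ_{i<n} (1 − yⁱ)` has norm `≤ max(‖n‖, ‖1 − y‖) ≤ r`. (With `n = p`, `r = ‖p‖`: `‖1 − y^p‖ ≤ ‖p‖²`.)
[cite: NeukirchANT1999, Ch. II (5.4)] [cite: Koblitz1984, Ch. IV §1] -/
theorem norm_one_sub_pow_le {y : K} {r : ℝ} (hr : ‖1 - y‖ ≤ r) (hr1 : r ≤ 1) (n : ℕ) (hn : ‖(n : K)‖ ≤ r) :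
    ‖1 - y ^ n‖ ≤ r * ‖1 - y‖ := by
  have hsum : ‖∑ i ∈ Finset.range n, y ^ i‖ ≤ r := by
    have e : ∑ i ∈ Finset.range n, y ^ i = (n : K) + -∑ i ∈ Finset.range n, (1 - y ^ i) := by
      rw [Finset.sum_sub_distrib, Finset.sum_const, Finset.card_range, nsmul_eq_mul, mul_one]; ring
    rw [e]
    refine (IsUltrametricDist.norm_add_le_max _ _).trans (max_le hn ?_)
    rw [norm_neg]
    exact IsUltrametricDist.norm_sum_le_of_forall_le_of_nonneg ((norm_nonneg _).trans hr)
      fun i _ => (norm_one_sub_pow_le_norm_one_sub (hr.trans hr1) i).trans hr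
  rw [← geom_sum_mul_neg, norm_mul]
  exact mul_le_mul_of_nonneg_right hsum (norm_nonneg _)

end NormEstimate

namespace CompletedAlgClosure

variable {F : Type} [Field F] [ValuativeRel F] [TopologicalSpace F] [IsNonarchimedeanLocalField F]
  [CharZero F] {p : ℕ} [hprime : Fact p.Prime]

/-- ★ **`‖1 − x‖ ≤ ‖p‖` and `log x = 0` force `x^p = 1` in `ℂ_F`**: if `x ∈ ℂ_F` satisfies `‖1 − x‖ ≤ ‖p‖` and the logarithm series
`Σ_{n≥1} −(1−x)ⁿ/n` sums to `0`, then `x^p = 1` — read through the `ℚ_p`-normalised norm of `PadicCompletedAlgClosure`: `‖1 − x^p‖ ≤ p⁻²`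
and the series is injective on `{‖1 − y‖ ≤ p⁻²}` (`p⁻² · p^{1/(p−1)} ≤ p⁻¹ < 1`), where `log(x^p) = p · log x = 0 = log 1`.
[cite: Koblitz1984, Ch. IV §2] [cite: NeukirchANT1999, Ch. II (5.5)] -/
theorem pow_prime_eq_one_of_hasSum_log_zero_of_norm_le (hp : valuation F p < 1) {x : CompletedAlgClosure F}
    (hx : ‖1 - x‖ ≤ ‖(p : CompletedAlgClosure F)‖)
    (h0 : HasSum (fun n : ℕ => -((1 - x) ^ (n + 1)) / (n + 1 : CompletedAlgClosure F)) 0) : x ^ p = 1 := by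
  let y : PadicCompletedAlgClosure F p hp := (PadicCompletedAlgClosure.toC hp).symm x
  have hprime' : p.Prime := hprime.out
  have hp1 : (1 : ℝ) < p := by exact_mod_cast hprime'.one_lt
  have hp0 : (0 : ℝ) < p := by linarith
  have hnp : ‖(p : PadicCompletedAlgClosure F p hp)‖ = (p : ℝ)⁻¹ := by
    rw [← map_natCast (algebraMap ℚ_[p] (PadicCompletedAlgClosure F p hp)), PadicCompletedAlgClosure.norm_algebraMap_padic,
      Padic.norm_p]
  -- `‖1 − y‖ ≤ p⁻¹` for the rescaled norm
  have hy1 : ‖1 - y‖ ≤ (p : ℝ)⁻¹ := by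
    rw [← hnp]
    refine (PadicCompletedAlgClosure.norm_le_iff hp (norm_nonneg _) (1 - y)).2 ?_
    rw [PadicCompletedAlgClosure.norm_rpow_normExponent, map_sub, map_one, map_natCast, RingEquiv.apply_symm_apply]
    exact hx
  have hlt1 : (p : ℝ)⁻¹ < 1 := inv_lt_one_of_one_lt₀ hp1
  have hy : ‖1 - y‖ < 1 := hy1.trans_lt hlt1
  -- `log y = 0`, hence `log (y^p) = log 1`
  have hsum : HasSum (fun n : ℕ => -((1 - y) ^ (n + 1)) / (n + 1 : PadicCompletedAlgClosure F p hp))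
      ((PadicCompletedAlgClosure.toC hp).symm 0) := (PadicCompletedAlgClosure.hasSum_iff hp).2 h0
  have hL : logSeries y = 0 := by
    have h := hsum.tsum_eq
    rwa [map_zero] at h
  have hLp : logSeries (y ^ p) = logSeries (1 : PadicCompletedAlgClosure F p hp) := by
    rw [logSeries_pow p hy, hL, mul_zero, logSeries_one]
  -- `‖1 − y^p‖ ≤ p⁻²`, inside the injectivity ball
  set ρ : ℝ := (p : ℝ)⁻¹ * (p : ℝ)⁻¹ with hρ
  have hρ0 : 0 ≤ ρ := mul_nonneg (inv_nonneg.2 hp0.le) (inv_nonneg.2 hp0.le)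
  have hyp : ‖1 - y ^ p‖ ≤ ρ :=
    (norm_one_sub_pow_le hy1 hlt1.le p (le_of_eq hnp)).trans (mul_le_mul_of_nonneg_left hy1 (inv_nonneg.2 hp0.le))
  have hθ : ρ * (p : ℝ) ^ (1 / ((p : ℝ) - 1)) < 1 := by
    have h2 : (2 : ℝ) ≤ p := by exact_mod_cast hprime'.two_le
    have hexp : 1 / ((p : ℝ) - 1) ≤ 1 := by rw [div_le_one (by linarith)]; linarith
    have hle : (p : ℝ) ^ (1 / ((p : ℝ) - 1)) ≤ p := by
      conv_rhs => rw [← Real.rpow_one (p : ℝ)]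
      exact Real.rpow_le_rpow_of_exponent_le hp1.le hexp
    calc ρ * (p : ℝ) ^ (1 / ((p : ℝ) - 1)) ≤ ρ * p := mul_le_mul_of_nonneg_left hle hρ0
      _ = (p : ℝ)⁻¹ := by rw [hρ]; field_simp
      _ < 1 := hlt1
  have hmem1 : (1 : PadicCompletedAlgClosure F p hp) ∈ {y : PadicCompletedAlgClosure F p hp | ‖1 - y‖ ≤ ρ} := by
    simp [hρ0]
  have heq := logSeries_injOn p (PadicCompletedAlgClosure F p hp) hθ hyp hmem1 hLp
  have h := congrArg (PadicCompletedAlgClosure.toC hp) heq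
  rwa [map_pow, map_one, RingEquiv.apply_symm_apply] at h

end CompletedAlgClosure

/-! ## §2 The uniform kernel on `X⁰_k` -/

namespace GaloisContinuity

variable {F : Type} [Field F] [ValuativeRel F] [TopologicalSpace F] [IsNonarchimedeanLocalField F]
  [CharZero F] {p : ℕ} [Fact p.Prime] [Fact (¬ IsUnit (p : integerC F))]
  [IsAdicComplete (Ideal.span {(p : integerC F)}) (integerC F)]

/-- ★★ **UNIFORM KERNEL, generator form.** If `[x] − 1 ∈ (p, ξ)` and `L` is a logarithm of `[x]` modulo `Fil^k` (`k ≥ 1`) with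
`θ(L) = 0`, then **`p · L − a · t ∈ ξ^k B_dR⁺` for some `a ∈ ℤ_p`**: `θ(L) = log(x♯) = 0` with `‖x♯ − 1‖ ≤ ‖p‖` gives `(x♯)^p = 1` (§1),
so `x^p = ε^a` (`PreTilt.exists_pow_eq_epsPow_of_untilt_pow_eq_one`) and `p·L`, `a·t` are two logarithms of `[ε^a]` modulo `Fil^k`.
[cite: FontaineOuyang2022, §6.1] [cite: FontaineAsterisque223III, Exp. II §1.2.3 and §1.5.4] -/
theorem IsLogModFil.exists_prime_mul_sub_mul_tBdR_mem (hp : valuation F p < 1) {k : ℕ} (hk : 1 ≤ k) {x : PreTilt (integerC F) p}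
    (hx : (teichmuller p x : Ainf (p := p) F) - 1 ∈ Ideal.span {(p : Ainf (p := p) F), xi}) {L : BDeRhamPlus (integerC F) p}
    (hL : IsLogModFil k ((teichmuller p x : Ainf (p := p) F) - 1) L) (h0 : thetaBdR L = 0) :
    ∃ a : ℤ_[p], (p : BDeRhamPlus (integerC F) p) * L - qpToBdR (a : ℚ_[p]) * tBdR ∈
      Ideal.span {(xiBdR : BDeRhamPlus (integerC F) p) ^ k} := by
  have h1 : (1 : Ainf (p := p) F) + ((teichmuller p x : Ainf (p := p) F) - 1) = teichmuller p x := by ring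
  -- `log(x♯) = 0` with `‖1 − x♯‖ ≤ ‖p‖`
  have hsum := hL.hasSum_thetaBdR hp hk hx
  rw [h0, h1, thetaBdR_ainfToBdR_teichmuller] at hsum
  have hle : ‖1 - ((PreTilt.untilt x : integerC F) : CompletedAlgClosure F)‖ ≤ ‖(p : CompletedAlgClosure F)‖ := by
    rw [norm_sub_rev]; exact (teichmuller_sub_one_mem_span_p_xi_iff x).1 hx
  -- `(x♯)^p = 1`, `x^p = ε^a`
  have hN := CompletedAlgClosure.pow_prime_eq_one_of_hasSum_log_zero_of_norm_le hp hle hsum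
  have hN' : PreTilt.untilt x ^ p ^ 1 = 1 := Subtype.ext (by rw [SubmonoidClass.coe_pow, pow_one, hN]; rfl)
  obtain ⟨a, ha⟩ := PreTilt.exists_pow_eq_epsPow_of_untilt_pow_eq_one x 1 hN'
  -- `p · L` and `a · t` are logarithms of `[ε^a]`
  have hpow := hL.pow_sub_one hx (p ^ 1)
  rw [h1, ← map_pow, ha, nsmul_eq_mul, Nat.cast_pow, pow_one] at hpow
  exact ⟨a, hpow.sub_mem_span_xiBdR_pow (isLogModFil_teichmuller_epsPow k a)⟩

/-- ★★ **UNIFORM KERNEL: `X⁰_k ∩ ker θ ⊆ p⁻¹ ℤ_p · t + Fil^k`.** For `k ≥ 1`, a Teichmüller logarithm `L` modulo `Fil^k` with `θ(L) = 0`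
satisfies **`p · L − a · t ∈ ξ^k B_dR⁺` for some `a ∈ ℤ_p`** — the exponent `N` of `IsTeichLog.exists_pow_mul_sub_mul_tBdR_mem` can be
taken `= 1` for every `p` (and `= 0` for odd `p`, not recorded). [cite: FontaineOuyang2022, §6.1] [cite: Koblitz1984, Ch. IV §2] -/
theorem IsTeichLog.exists_prime_mul_sub_mul_tBdR_mem (hp : valuation F p < 1) {k : ℕ} (hk : 1 ≤ k) {L : BDeRhamPlus (integerC F) p}
    (hL : IsTeichLog k L) (h0 : thetaBdR L = 0) :
    ∃ a : ℤ_[p], (p : BDeRhamPlus (integerC F) p) * L - qpToBdR (a : ℚ_[p]) * tBdR ∈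
      Ideal.span {(xiBdR : BDeRhamPlus (integerC F) p) ^ k} := by
  obtain ⟨x, hx, h⟩ := hL
  exact h.exists_prime_mul_sub_mul_tBdR_mem hp hk ((teichmuller_sub_one_mem_span_p_xi_iff_coeff_zero x).2 hx) h0

/-! ## §3 In the currency of the assembly socket: `p · E ≡ ι ∘ h (mod Fil²)` with `h` unique -/

open BdRPlusTop

omit [CharZero F] in
/-- Membership in `ξ^k B_dR⁺` read in `BdRPlusTop F p`: `of b ∈ WithIdeal.i ^ k`. [cite: FontaineAsterisque223III, Exp. II §1.5.3] -/
theorem of_mem_ideal_pow_iff (k : ℕ) (b : BDeRhamPlus (integerC F) p) :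
    BdRPlusTop.of F p b ∈ (WithIdeal.i ^ k : Ideal (BdRPlusTop F p)) ↔ b ∈ Ideal.span {(xiBdR : BDeRhamPlus (integerC F) p) ^ k} := by
  rw [BdRPlusTop.ideal_eq, Ideal.span_singleton_pow]
  exact Iff.rfl

/-- ★ **`p · E ≡ ι ∘ h (mod Fil²)`.** If a cochain `E : Γ → B_dR⁺(F)` takes Teichmüller-logarithm values modulo `Fil²` killed by `θ`, then
**`p · E(σ) − ι(h σ) ∈ Fil² B_dR⁺` for some `h : Γ → ℤ_p(1)(F̄)`** (`ι = periodLine`, `ι(ε^a) = a · t`). Continuity of `h` is not asserted.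
[cite: FontaineOuyang2022, §6.1] [cite: Kato1993LNM1553, Ch. II §1.4 (proof of Lemma 1.4.3)] -/
theorem exists_periodLine_sub_mem_sq_of_isTeichLog (hp : valuation F p < 1) {Γ : Type*} (E : Γ → BdRPlusTop F p)
    (hE : ∀ σ, IsTeichLog 2 ((BdRPlusTop.of F p).symm (E σ))) (h0 : ∀ σ, thetaBdR ((BdRPlusTop.of F p).symm (E σ)) = 0) :
    ∃ h : Γ → (GaloisCohomology.muPadicSystem F p).limit,
      ∀ σ, (p : BdRPlusTop F p) * E σ - periodLine F p (h σ) ∈ (WithIdeal.i ^ 2 : Ideal (BdRPlusTop F p)) := by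
  have key : ∀ σ, ∃ a : ℤ_[p], (p : BdRPlusTop F p) * E σ - periodLine F p (epsLineEquiv F p a) ∈
      (WithIdeal.i ^ 2 : Ideal (BdRPlusTop F p)) := fun σ => by
    obtain ⟨a, ha⟩ := (hE σ).exists_prime_mul_sub_mul_tBdR_mem hp (by norm_num) (h0 σ)
    refine ⟨a, ?_⟩
    rw [periodLine_epsLineEquiv, ← (BdRPlusTop.of F p).apply_symm_apply (E σ), ← map_natCast (BdRPlusTop.of F p), ← map_mul,
      ← map_sub, of_mem_ideal_pow_iff]
    exact ha
  choose a ha using key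
  exact ⟨fun σ => epsLineEquiv F p (a σ), ha⟩

/-- ★ **Uniqueness modulo `Fil^k` (`k ≥ 2`): `ℤ_p · t ∩ Fil² = 0`.** If `b − ι(ζ)` and `b − ι(ζ')` both lie in `Fil^k B_dR⁺`, `k ≥ 2`, then
`ζ = ζ'` (`BdRPlusTop.eq_zero_of_periodLine_mem_ideal_sq`). [cite: Kato1993LNM1553, Ch. II §1.1 and §1.4] -/
theorem periodLine_unique_mod_pow (hp : valuation F p < 1) (hF : Function.Surjective (fontaineTheta (integerC F) p)) {k : ℕ}
    (hk : 2 ≤ k) {b : BdRPlusTop F p} {ζ ζ' : (GaloisCohomology.muPadicSystem F p).limit}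
    (h : b - periodLine F p ζ ∈ (WithIdeal.i ^ k : Ideal (BdRPlusTop F p)))
    (h' : b - periodLine F p ζ' ∈ (WithIdeal.i ^ k : Ideal (BdRPlusTop F p))) : ζ = ζ' := by
  have hle : (WithIdeal.i ^ k : Ideal (BdRPlusTop F p)) ≤ WithIdeal.i ^ 2 := Ideal.pow_le_pow_right hk
  have hd : periodLine F p (ζ' - ζ) ∈ (WithIdeal.i ^ 2 : Ideal (BdRPlusTop F p)) := by
    have e : periodLine F p (ζ' - ζ) = (b - periodLine F p ζ) - (b - periodLine F p ζ') := by rw [map_sub]; ring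
    rw [e]
    exact hle (Ideal.sub_mem _ h h')
  have h0 := eq_zero_of_periodLine_mem_ideal_sq hp hF hd
  rwa [sub_eq_zero, eq_comm] at h0

/-- **The correction cochain inherits the algebraic identities of `E`.** If `p · E(σ) ≡ ι(h σ)`, `p · E(τ') ≡ ι(h τ')` and
`p · E(ρ') ≡ ι(h ρ')` modulo `Fil²` and `E(ρ') = E(σ) + g(E(τ'))` for an additive `g : B_dR⁺ → B_dR⁺` preserving `Fil²`, fixing `p` and
with `g ∘ ι = ι ∘ γ`, then `h ρ' = h σ + γ(h τ')` — e.g. `g = σ`, `γ = σ` on `ℤ_p(1)`: a twisted cocycle identity of `E` modulo `Fil²`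
passes to `h` EXACTLY. [cite: NeukirchSchmidtWingberg2008, I §3 (1.3.2)] [cite: Kato1993LNM1553, Ch. II §1.4] -/
theorem sub_periodLine_cochain_identity (hp : valuation F p < 1) (hF : Function.Surjective (fontaineTheta (integerC F) p))
    {E₁ E₂ E₃ : BdRPlusTop F p} {h₁ h₂ h₃ : (GaloisCohomology.muPadicSystem F p).limit}
    (e₁ : (p : BdRPlusTop F p) * E₁ - periodLine F p h₁ ∈ (WithIdeal.i ^ 2 : Ideal (BdRPlusTop F p)))
    (e₂ : (p : BdRPlusTop F p) * E₂ - periodLine F p h₂ ∈ (WithIdeal.i ^ 2 : Ideal (BdRPlusTop F p)))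
    (e₃ : (p : BdRPlusTop F p) * E₃ - periodLine F p h₃ ∈ (WithIdeal.i ^ 2 : Ideal (BdRPlusTop F p)))
    (g : BdRPlusTop F p →+ BdRPlusTop F p) (hg : ∀ b ∈ (WithIdeal.i ^ 2 : Ideal (BdRPlusTop F p)), g b ∈ (WithIdeal.i ^ 2 : Ideal (BdRPlusTop F p)))
    (hgp : ∀ b, g ((p : BdRPlusTop F p) * b) = (p : BdRPlusTop F p) * g b)
    (γ : (GaloisCohomology.muPadicSystem F p).limit →+ (GaloisCohomology.muPadicSystem F p).limit)
    (hgι : ∀ ζ, g (periodLine F p ζ) = periodLine F p (γ ζ))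
    {d : (GaloisCohomology.muPadicSystem F p).limit}
    (hE : E₃ = E₁ + g E₂ + periodLine F p d) : h₃ = h₁ + γ h₂ + (p : ℤ) • d := by
  refine periodLine_unique_mod_pow hp hF (le_refl 2) e₃ ?_
  have e : (p : BdRPlusTop F p) * E₃ - periodLine F p (h₁ + γ h₂ + (p : ℤ) • d) =
      ((p : BdRPlusTop F p) * E₁ - periodLine F p h₁) + g ((p : BdRPlusTop F p) * E₂ - periodLine F p h₂) := by
    rw [hE, map_add, map_add, map_sub, hgp, hgι, map_zsmul, zsmul_eq_mul, Int.cast_natCast]; ring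
  rw [e]
  exact Ideal.add_mem _ e₁ (hg _ e₂)

end GaloisContinuity

end Literature.NumberTheory.PAdicHodge

end
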